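import Summits.QuantumFields.YangMills.Theorems.BalabanUVNodesN15NeumannCubeDefect
import Summits.QuantumFields.YangMills.Theorems.BalabanUVNodesN15FullPropagatorBackwardEntry
import Summits.QuantumFields.YangMills.Theorems.BalabanUVNodesN15TwoGridHolder
import HarnessLib

/-!
# Route «BalabanUVNodes» (K3⁷), node N15 = NE2, -a lane, PROGRAMME N file N-IIe: THE η-DEFECT OF ENTRY 1 OF THE NEUMANN CUBE PROPAGATORS — the exact identity (per image: the torus
# defects of `∇_νG` and of `S_{−ν}∇_νG`, plus face terms with SECOND differences) and the letter `𝔇(χ′_□∇′_νG′(□), χ_□∇_νG(□)) ≤ 1_□1_□·m·(L^k)^{−1∕16}·e^{−δd}`, HYPOTHESIS-FREE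

Cell `pub-ymgap`, seat `pub-ymgap-dag-n15-a` (KNIT-BY-NAME, g19; D-0062; chair R424 venue; `bears_on: R4∕N15`); `--kind proof --supports stmt-QuantumFields-20544 --as helper`.
Sequel of N-IIc `…N15NeumannCubeDefect` (entry 0's defect).  Inputs BY NAME: this lane's part 53 `hasMaj_twoGridDefect_grad` (`𝔇(∇′_νG′, ∇_νG)`, rate `(L^k)^{−1∕16}`), dag-n15-c W1
`GenuineSite.hasMaj_twoGridDefect_grad_backward` (`𝔇(S′_{−ν}∇′_νG′, S_{−ν}∇_νG)`, same rate), part 44 `hasMaj_gradStep_of_ineq` (Hölder second differences `∇_μ∇_νG ≤ C·n^{1−α}e^{−δd}`),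
`ineq110_114_pair`, W1 `hasMaj_bshiftV_comp`; N-IIIc `gradImg`∕`mulOp_comp_sD_comp_symOp_comp`; N-IIa∕b∕c (`reflSet_pull_kingPrV`, `neumannCubeG_eq_chiCube`, `hasMaj_faceTerm`,
`hasMaj_ownDiff_comp`, `hasMaj_comp_mulOp_chiCube`).  CONSUMER: dag-n15-c's `hDK` rows (FILE 45 `hasMaj_idef_glued_of_cubes`) through their Leibniz files 46∕52∕56, which reduce the defect
of the commutator pieces to the defects of the cubes' ENTRIES — entry 0 is N-IIc, entry 1 is this file.

WHAT.  §18 `symbOp_sD_comp_bshiftV(_comp)` (forward differences commute with the backward shift), `symbOp_sD_comp_gradImg_of_mem`, `gradImg_comp_of_(not_)mem`, `comp_gradImg_of_(not_)mem`,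
`idef_neg_neg`, `idef_finset_sum`, ★★★ `idef_chiCube_grad_neumannCubeG` (EXACT: `𝔇(E′_□, E_□) = Σ_T [χ′_□∘R′_T∘𝔇(∇_ν^{(T)}G′, ∇_ν^{(T)}G)∘M_{χ_□} + M_{mask_T}∘P∘(M_{χ_□}∘R_T∘((D∘∇_ν^{(T)})∘G∘M_{χ_□}))]`,
`E_□ = χ_□∘∇_ν∘G(□ + c)`), ★★★ `idef_chiCube_grad_neumannCubeG_split` (the same with the images paired by the bond's direction, `T ↦ (T, T ∪ {ν})` over `T ∌ ν`: no case distinction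
inside — `∇_ν^{(T)} = ∇_ν`, `∇_ν^{(T∪{ν})} = −S_{−ν}∇_ν`).  §19 ★★★ `hasMaj_idef_chiCube_grad_neumannCubeG_of` (ANY torus `M_ν = 2S`, `n = L^k`, `n′ = L^r·n`: torus defects `C₀, C₀′`,
second differences `C₃, C₃′` ⟹ `𝔇(E′_□, E_□) ≤ 1_□1_□·2^{d}e^{δ}(C₀ + C₀′ + (d+1)(C₃ + C₃′)∕L^k)·e^{−δd}`), ★★★ `hasMaj_idef_chiCube_grad_neumannCubeG`: for odd `L ≥ 3`, `a > 0`: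
`∃ δ m > 0, ∀ m_T k r (k ≥ 1, L^k ≥ 4) (hL) c ν`, `𝔇(χ′_□∇′_νG′(□), χ_□∇_νG(□)) ≤ 1_□(y)1_□(y′)·m·(L^k)^{−1∕16}·e^{−δ|y−y′|_T}` (Hölder exponent `α = ½` for the faces:
`(L^k)^{−½} ≤ (L^k)^{−1∕16}`; `L^k ≥ 4` is part 44's standing hypothesis).
HONEST FRAMING.  Lattice algebra + block-majorant bookkeeping over LANDED torus letters; no new analytic estimate; `U ≡ 1` torus MODEL on the doubled-cube family (one-cube model — ref-B
OBSERVATION-2∕CAUTION-P (4): the multi-cube embedding and (2.92)'s Landau mismatch are NOT typed); nothing of [B6] (2.134)∕(2.38)–(2.40) ∕ [B9] Thm 3.14 asserted; N15 NOT discharged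
(object-bound; NE2⁺ NOT PRINTED); counts UNMOVED (typed 28∕28 · discharged 5∕27); one finite torus pair per index — NOT continuum ∕ ℝ⁴ ∕ OS ∕ mass gap ∕ Clay.  Theorems only (0 `def`).
-/

noncomputable section

open scoped BigOperators Matrix
open Finset

namespace Summit.QuantumFields.YangMills.BalabanUVNodes.N15.TwoGrid

open Literature.MathematicalPhysics.QuantumFieldTheory.Balaban1983to89
open Literature.MathematicalPhysics.QuantumFieldTheory.Balaban1983to89.B5Prop11Plancherel (Tor fine unitVec)
open Literature.MathematicalPhysics.QuantumFieldTheory.Balaban1983to89.B5Block118 (up bpt)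
open Literature.MathematicalPhysics.QuantumFieldTheory.Balaban1983to89.B6Prop26Gluing (mulOp mulOp_apply ind ind_nonneg ind_le_one)
open Literature.MathematicalPhysics.QuantumFieldTheory.King1986.Torus (blockOf tdistT)
open Literature.MathematicalPhysics.QuantumFieldTheory.Balaban1983to89.B11SectG (BlockNorm HasMaj)
open Literature.MathematicalPhysics.QuantumFieldTheory.Balaban1983to89.B6UnitTorusCarrier (unitTorusGeo)
open Literature.MathematicalPhysics.QuantumFieldTheory.Balaban1983to89.B5SiteBridgeP12 (MP)
open Literature.MathematicalPhysics.QuantumFieldTheory.Balaban1983to89.B5SettingP12Real (latticeSettingP12R)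
open Literature.MathematicalPhysics.QuantumFieldTheory.Balaban1983to89.T4EtaRateDefect (idef idef_comp idef_apply)
open Literature.MathematicalPhysics.QuantumFieldTheory.Balaban1983to89.T4EtaRateCoeffDefect (pull pull_apply)
open Summit.QuantumFields.YangMills.BalabanUVNodes.N15.VectorPiece (blkFine kingPr kingPrV blkFine_comp_kingPrV bshiftV bshiftV_apply hasMaj_bshiftV_comp)

variable {d : ℕ}

/-! ## §18 THE η-DEFECT OF ENTRY 1 OF THE NEUMANN CUBES: exact identity (per image: the torus defects of `∇G` and of `S_{−ν}∇G`, plus face terms with SECOND differences) and the letter -/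

section GradientDefect

variable {M : Fin (d + 1) → ℕ} [∀ μ, NeZero (M μ)] {n : ℕ} [NeZero n] {c : Tor M} {S : ℕ}

omit [∀ μ, NeZero (M μ)] [NeZero n] in
/-- forward differences commute with the backward shift. [folklore] -/
theorem symbOp_sD_comp_bshiftV (μ ν : Fin (d + 1)) (cc : ℝ) : symbOp M n (sD M n μ cc) ∘ₗ bshiftV M n ν = bshiftV M n ν ∘ₗ symbOp M n (sD M n μ cc) := by
  refine LinearMap.ext fun A => funext fun b => ?_
  simp only [LinearMap.comp_apply, symbOp_sD_apply, bshiftV_apply, add_sub_right_comm]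

omit [∀ μ, NeZero (M μ)] [NeZero n] in
/-- the same, composed with any `X`. [folklore] -/
theorem symbOp_sD_comp_bshiftV_comp {F₁ : Type} [AddCommGroup F₁] [Module ℝ F₁] (μ ν : Fin (d + 1)) (cc : ℝ) (X : F₁ →ₗ[ℝ] (Tor (fine n M) × Fin (d + 1) → ℝ)) :
    symbOp M n (sD M n μ cc) ∘ₗ (bshiftV M n ν ∘ₗ X) = bshiftV M n ν ∘ₗ (symbOp M n (sD M n μ cc) ∘ₗ X) := by
  refine LinearMap.ext fun f => funext fun b => ?_
  simp only [LinearMap.comp_apply, symbOp_sD_apply, bshiftV_apply, add_sub_right_comm]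

omit [∀ μ, NeZero (M μ)] [NeZero n] in
/-- `∇_μ ∘ (∇_ν^{(T)} ∘ X) = −S_{−ν} ∘ (∇_μ ∘ ∇_ν ∘ X)` for a reflected direction. [folklore] -/
theorem symbOp_sD_comp_gradImg_of_mem {F₁ : Type} [AddCommGroup F₁] [Module ℝ F₁] {T : Finset (Fin (d + 1))} {ν : Fin (d + 1)} (hν : ν ∈ T) (μ : Fin (d + 1)) (cc c' : ℝ)
    (X : F₁ →ₗ[ℝ] (Tor (fine n M) × Fin (d + 1) → ℝ)) :
    symbOp M n (sD M n μ c') ∘ₗ (gradImg M n ν T cc ∘ₗ X) = -(bshiftV M n ν ∘ₗ (symbOp M n (sD M n μ c') ∘ₗ symbOp M n (sD M n ν cc) ∘ₗ X)) := by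
  rw [gradImg, if_pos hν]
  refine LinearMap.ext fun f => funext fun b => ?_
  simp only [LinearMap.neg_comp, LinearMap.comp_neg, LinearMap.neg_apply, Pi.neg_apply, LinearMap.comp_apply, symbOp_sD_apply, bshiftV_apply,
    add_sub_right_comm]

omit [∀ μ, NeZero (M μ)] [NeZero n] in
/-- `∇_ν^{(T)} ∘ X = ∇_ν ∘ X` for a direction not reflected. [folklore] -/
theorem gradImg_comp_of_not_mem {F₁ : Type} [AddCommGroup F₁] [Module ℝ F₁] {T : Finset (Fin (d + 1))} {ν : Fin (d + 1)} (hν : ν ∉ T) (cc : ℝ)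
    (X : F₁ →ₗ[ℝ] (Tor (fine n M) × Fin (d + 1) → ℝ)) : gradImg M n ν T cc ∘ₗ X = symbOp M n (sD M n ν cc) ∘ₗ X := by
  rw [gradImg, if_neg hν]

omit [∀ μ, NeZero (M μ)] [NeZero n] in
/-- `∇_ν^{(T)} ∘ X = −(S_{−ν} ∘ (∇_ν ∘ X))` for a reflected direction. [folklore] -/
theorem gradImg_comp_of_mem {F₁ : Type} [AddCommGroup F₁] [Module ℝ F₁] {T : Finset (Fin (d + 1))} {ν : Fin (d + 1)} (hν : ν ∈ T) (cc : ℝ)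
    (X : F₁ →ₗ[ℝ] (Tor (fine n M) × Fin (d + 1) → ℝ)) : gradImg M n ν T cc ∘ₗ X = -(bshiftV M n ν ∘ₗ (symbOp M n (sD M n ν cc) ∘ₗ X)) := by
  rw [gradImg, if_pos hν, LinearMap.neg_comp, LinearMap.comp_assoc]

/-- `𝔇(−T′, −T) = −𝔇(T′, T)`. [folklore] -/
theorem idef_neg_neg {F₁ F₁' F₂ F₂' : Type} [AddCommGroup F₁] [Module ℝ F₁] [AddCommGroup F₁'] [Module ℝ F₁'] [AddCommGroup F₂] [Module ℝ F₂] [AddCommGroup F₂'] [Module ℝ F₂']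
    (τ₁ : F₁ →ₗ[ℝ] F₁') (τ₂ : F₂ →ₗ[ℝ] F₂') (T' : F₁' →ₗ[ℝ] F₂') (T : F₁ →ₗ[ℝ] F₂) : idef τ₁ τ₂ (-T') (-T) = -idef τ₁ τ₂ T' T := by
  rw [idef, idef, LinearMap.neg_comp, LinearMap.comp_neg, neg_sub_neg, neg_sub]

/-- the η-defect of a finite sum of pairs is the sum of the η-defects. [folklore] -/
theorem idef_finset_sum {ι F₁ F₂ : Type} [AddCommGroup F₁] [Module ℝ F₁] [AddCommGroup F₂] [Module ℝ F₂] (τ : F₁ →ₗ[ℝ] F₂) (s : Finset ι)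
    (T' : ι → F₂ →ₗ[ℝ] F₂) (T : ι → F₁ →ₗ[ℝ] F₁) : idef τ τ (∑ i ∈ s, T' i) (∑ i ∈ s, T i) = ∑ i ∈ s, idef τ τ (T' i) (T i) := by
  simp only [idef, fsum_comp, comp_fsum, ← Finset.sum_sub_distrib]

/-- ★★★ **THE η-DEFECT OF ENTRY 1 OF THE CUBE-LOCALIZED NEUMANN PROPAGATORS, EXACTLY**: with `E_□ = χ_□ ∘ ∇_ν ∘ G(□ + c)` (coarse, `∇_ν = ρ(n(s_ν − 1))`) and its fine twin,
`𝔇(E′_□, E_□) = Σ_T [χ′_□ ∘ R′_T ∘ 𝔇(∇_ν^{(T)}G′, ∇_ν^{(T)}G) ∘ M_{χ_□} + M_{mask_T} ∘ P ∘ (M_{χ_□} ∘ R_T ∘ ((D ∘ ∇_ν^{(T)}) ∘ G ∘ M_{χ_□}))]` — per image the TORUS defect of `∇_νG`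
(`ν ∉ T`) or of `−S_{−ν}∇_νG` (`ν ∈ T`), plus a face term carrying a SECOND difference of `G`. [cite: Balaban1985BackgroundPropagators, Thm 3.14 pp.426–427, (3.42) p.397 (shape);
Balaban1984PropagatorsII, (2.37) p.229 (images)] -/
theorem idef_chiCube_grad_neumannCubeG (L k r : ℕ) [NeZero L] (c : Tor M) (S : ℕ) (a : ℝ) (hM : ∀ ν, M ν = 2 * S) (ha : 0 < a) (ν : Fin (d + 1)) :
    idef (pull (kingPrV L k r M)) (pull (kingPrV L k r M))
        (mulOp (chiCube M (L ^ r * L ^ k) c S) ∘ₗ symbOp M (L ^ r * L ^ k) (sD M (L ^ r * L ^ k) ν ((L ^ r * L ^ k : ℕ) : ℝ)) ∘ₗ neumannCubeG M (L ^ r * L ^ k) c S a)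
        (mulOp (chiCube M (L ^ k) c S) ∘ₗ symbOp M (L ^ k) (sD M (L ^ k) ν ((L ^ k : ℕ) : ℝ)) ∘ₗ neumannCubeG M (L ^ k) c S a) =
      ∑ T ∈ (Finset.univ : Finset (Fin (d + 1))).powerset,
        (mulOp (chiCube M (L ^ r * L ^ k) c S) ∘ₗ reflSet M (L ^ r * L ^ k) c T ∘ₗ
            idef (pull (kingPrV L k r M)) (pull (kingPrV L k r M))
              (gradImg M (L ^ r * L ^ k) ν T ((L ^ r * L ^ k : ℕ) : ℝ) ∘ₗ gOp M (L ^ r * L ^ k) a) (gradImg M (L ^ k) ν T ((L ^ k : ℕ) : ℝ) ∘ₗ gOp M (L ^ k) a) ∘ₗ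
            mulOp (chiCube M (L ^ k) c S) +
          mulOp (faceMask M (L ^ r * L ^ k) (L ^ r) T) ∘ₗ pull (kingPrV L k r M) ∘ₗ
            (mulOp (chiCube M (L ^ k) c S) ∘ₗ reflSet M (L ^ k) c T ∘ₗ
              ((ownDiff M (L ^ k) ∘ₗ gradImg M (L ^ k) ν T ((L ^ k : ℕ) : ℝ)) ∘ₗ gOp M (L ^ k) a ∘ₗ mulOp (chiCube M (L ^ k) c S)))) := by
  have hL0 : 0 < L := Nat.pos_of_ne_zero (NeZero.ne L)
  have hn : 1 ≤ L ^ k := Nat.one_le_pow _ _ hL0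
  have hn' : 1 ≤ L ^ r * L ^ k := Nat.one_le_iff_ne_zero.mpr (Nat.mul_ne_zero (pow_ne_zero r (NeZero.ne L)) (by positivity))
  rw [neumannCubeG_eq_chiCube M (L ^ r * L ^ k) c S a hM hn' ha, neumannCubeG_eq_chiCube M (L ^ k) c S a hM hn ha, mulOp_comp_sD_comp_symOp_comp,
    mulOp_comp_sD_comp_symOp_comp, idef_finset_sum]
  refine Finset.sum_congr rfl fun T _ => LinearMap.ext fun f => ?_
  have hχ : ∀ u : Tor (fine (L ^ k) M) × Fin (d + 1) → ℝ,
      pull (kingPrV L k r M) (mulOp (chiCube M (L ^ k) c S) u) = mulOp (chiCube M (L ^ r * L ^ k) c S) (pull (kingPrV L k r M) u) := fun u => by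
    have := LinearMap.congr_fun (pull_kingPrV_comp_mulOp_chiCube L k r c S) u
    simpa only [LinearMap.comp_apply] using this
  have hR : ∀ Y : Tor (fine (L ^ k) M) × Fin (d + 1) → ℝ, pull (kingPrV L k r M) (reflSet M (L ^ k) c T Y) =
      reflSet M (L ^ r * L ^ k) c T (pull (kingPrV L k r M) Y) -
        mulOp (faceMask M (L ^ r * L ^ k) (L ^ r) T) (pull (kingPrV L k r M) (reflSet M (L ^ k) c T (ownDiff M (L ^ k) Y))) := fun Y => by
    rw [reflSet_pull_kingPrV, add_sub_cancel_right]
  simp only [idef_apply, LinearMap.comp_apply, LinearMap.add_apply]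
  rw [← hχ f, hχ (reflSet M (L ^ k) c T _), hR]
  funext b'
  simp only [map_sub, Pi.sub_apply, Pi.add_apply, mulOp_apply, pull_apply, chiCube_kingPrV]
  ring

omit [∀ μ, NeZero (M μ)] [NeZero n] in
/-- `Y ∘ ∇_ν^{(T)} = Y ∘ ∇_ν` for a direction not reflected. [folklore] -/
theorem comp_gradImg_of_not_mem {F₃ : Type} [AddCommGroup F₃] [Module ℝ F₃] {T : Finset (Fin (d + 1))} {ν : Fin (d + 1)} (hν : ν ∉ T) (cc : ℝ)
    (Y : (Tor (fine n M) × Fin (d + 1) → ℝ) →ₗ[ℝ] F₃) : Y ∘ₗ gradImg M n ν T cc = Y ∘ₗ symbOp M n (sD M n ν cc) := by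
  rw [gradImg, if_neg hν]

omit [∀ μ, NeZero (M μ)] [NeZero n] in
/-- `Y ∘ ∇_ν^{(T)} = −(Y ∘ S_{−ν} ∘ ∇_ν)` for a reflected direction. [folklore] -/
theorem comp_gradImg_of_mem {F₃ : Type} [AddCommGroup F₃] [Module ℝ F₃] {T : Finset (Fin (d + 1))} {ν : Fin (d + 1)} (hν : ν ∈ T) (cc : ℝ)
    (Y : (Tor (fine n M) × Fin (d + 1) → ℝ) →ₗ[ℝ] F₃) : Y ∘ₗ gradImg M n ν T cc = -(Y ∘ₗ bshiftV M n ν ∘ₗ symbOp M n (sD M n ν cc)) := by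
  rw [gradImg, if_pos hν, LinearMap.comp_neg]

/-- ★★★ **THE SAME IDENTITY WITH THE IMAGES PAIRED BY THE BOND's DIRECTION** (no case distinction inside): over the `2^d` subsets `T ∌ ν`, the pair `(T, T ∪ {ν})` contributes the
images-dressed torus defect of `∇_νG` with its face term (second difference `D∘∇_ν`), MINUS the images-dressed torus defect of `S_{−ν}∇_νG` with its face term (`D∘S_{−ν}∇_ν`).
[cite: Balaban1985BackgroundPropagators, Thm 3.14 pp.426–427, (3.42) p.397 (shape); Balaban1984PropagatorsII, (2.37) p.229 (images)] -/
theorem idef_chiCube_grad_neumannCubeG_split (L k r : ℕ) [NeZero L] (c : Tor M) (S : ℕ) (a : ℝ) (hM : ∀ ν, M ν = 2 * S) (ha : 0 < a) (ν : Fin (d + 1)) :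
    idef (pull (kingPrV L k r M)) (pull (kingPrV L k r M))
        (mulOp (chiCube M (L ^ r * L ^ k) c S) ∘ₗ symbOp M (L ^ r * L ^ k) (sD M (L ^ r * L ^ k) ν ((L ^ r * L ^ k : ℕ) : ℝ)) ∘ₗ neumannCubeG M (L ^ r * L ^ k) c S a)
        (mulOp (chiCube M (L ^ k) c S) ∘ₗ symbOp M (L ^ k) (sD M (L ^ k) ν ((L ^ k : ℕ) : ℝ)) ∘ₗ neumannCubeG M (L ^ k) c S a) =
      ∑ T ∈ ((Finset.univ : Finset (Fin (d + 1))).erase ν).powerset,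
        ((mulOp (chiCube M (L ^ r * L ^ k) c S) ∘ₗ reflSet M (L ^ r * L ^ k) c T ∘ₗ
              idef (pull (kingPrV L k r M)) (pull (kingPrV L k r M))
                (symbOp M (L ^ r * L ^ k) (sD M (L ^ r * L ^ k) ν ((L ^ r * L ^ k : ℕ) : ℝ)) ∘ₗ gOp M (L ^ r * L ^ k) a)
                (symbOp M (L ^ k) (sD M (L ^ k) ν ((L ^ k : ℕ) : ℝ)) ∘ₗ gOp M (L ^ k) a) ∘ₗ
              mulOp (chiCube M (L ^ k) c S) +
            mulOp (faceMask M (L ^ r * L ^ k) (L ^ r) T) ∘ₗ pull (kingPrV L k r M) ∘ₗ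
              (mulOp (chiCube M (L ^ k) c S) ∘ₗ reflSet M (L ^ k) c T ∘ₗ
                ((ownDiff M (L ^ k) ∘ₗ symbOp M (L ^ k) (sD M (L ^ k) ν ((L ^ k : ℕ) : ℝ))) ∘ₗ gOp M (L ^ k) a ∘ₗ mulOp (chiCube M (L ^ k) c S)))) -
          (mulOp (chiCube M (L ^ r * L ^ k) c S) ∘ₗ reflSet M (L ^ r * L ^ k) c (insert ν T) ∘ₗ
              idef (pull (kingPrV L k r M)) (pull (kingPrV L k r M))
                (bshiftV M (L ^ r * L ^ k) ν ∘ₗ (symbOp M (L ^ r * L ^ k) (sD M (L ^ r * L ^ k) ν ((L ^ r * L ^ k : ℕ) : ℝ)) ∘ₗ gOp M (L ^ r * L ^ k) a))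
                (bshiftV M (L ^ k) ν ∘ₗ (symbOp M (L ^ k) (sD M (L ^ k) ν ((L ^ k : ℕ) : ℝ)) ∘ₗ gOp M (L ^ k) a)) ∘ₗ
              mulOp (chiCube M (L ^ k) c S) +
            mulOp (faceMask M (L ^ r * L ^ k) (L ^ r) (insert ν T)) ∘ₗ pull (kingPrV L k r M) ∘ₗ
              (mulOp (chiCube M (L ^ k) c S) ∘ₗ reflSet M (L ^ k) c (insert ν T) ∘ₗ
                ((ownDiff M (L ^ k) ∘ₗ bshiftV M (L ^ k) ν ∘ₗ symbOp M (L ^ k) (sD M (L ^ k) ν ((L ^ k : ℕ) : ℝ))) ∘ₗ gOp M (L ^ k) a ∘ₗ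
                  mulOp (chiCube M (L ^ k) c S))))) := by
  rw [idef_chiCube_grad_neumannCubeG L k r c S a hM ha ν]
  conv_lhs => rw [← Finset.insert_erase (Finset.mem_univ ν)]
  rw [Finset.sum_powerset_insert (Finset.notMem_erase ν _), ← Finset.sum_add_distrib]
  refine Finset.sum_congr rfl fun T hT => ?_
  have hνT : ν ∉ T := fun h => Finset.notMem_erase ν _ (Finset.mem_powerset.mp hT h)
  have hνT' : ν ∈ insert ν T := Finset.mem_insert_self ν T
  simp only [gradImg_comp_of_not_mem hνT, comp_gradImg_of_not_mem hνT, gradImg_comp_of_mem hνT', comp_gradImg_of_mem hνT', idef_neg_neg,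
    LinearMap.comp_neg, LinearMap.neg_comp]
  abel

end GradientDefect

/-! ## §19 The letter: `𝔇(E′_□, E_□) ≤ 1_□1_□·m·(L^k)^{−1∕16}·e^{−δd}` from the torus defects of `∇G` and `S_{−ν}∇G` (parts 53 ∕ W1) and the Hölder second-difference letters -/

section GradientLetter

open Literature.MathematicalPhysics.QuantumFieldTheory.Balaban1983to89.B5CoverP12Lattice (Lθ Lθ_nonneg)

variable {L : ℕ} [NeZero L] {M : Fin (d + 1) → ℕ} [∀ μ, NeZero (M μ)] {k r : ℕ} {c : Tor M} {S : ℕ}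

/-- ★★★ **THE η-DEFECT OF ENTRY 1 OF THE NEUMANN CUBES FROM TORUS LETTERS** (any torus `M_ν = 2S`, `n = L^k`, `n′ = L^r·n`): the torus defects `𝔇(∇′_νG′, ∇_νG)`, `𝔇(S′_{−ν}∇′_νG′, S_{−ν}∇_νG)
≤ C₀e^{−δd}, C₀′e^{−δd}` and the second differences `∇_μ∇_νG ≤ C₃e^{−δd}`, `S_{−ν}∇_μ∇_νG ≤ C₃′e^{−δd}` ⟹ `𝔇(E′_□, E_□) ≤ 1_□1_□·2^{d}e^{δ}(C₀ + C₀′ + (d+1)(C₃ + C₃′)∕L^k)·e^{−δd}`.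
[cite: Balaban1985BackgroundPropagators, Thm 3.14 pp.426–427, (3.42) p.397 (shape); Balaban1984PropagatorsII, (2.134) p.247 (shape), (2.37) p.229] -/
theorem hasMaj_idef_chiCube_grad_neumannCubeG_of (hM : ∀ ν, M ν = 2 * S) {a : ℝ} (ha : 0 < a) (ν : Fin (d + 1)) {C₀ C₀' C₃ C₃' δ : ℝ} (hC₀ : 0 ≤ C₀) (hC₀' : 0 ≤ C₀')
    (hC₃ : 0 ≤ C₃) (hC₃' : 0 ≤ C₃') (hδ : 0 ≤ δ)
    (h0a : HasMaj (BlockNorm.ofBlocks (unitTorusGeo L k M) (fun b : Tor (fine (L ^ k) M) × Fin (d + 1) => blockOf (L ^ k) M b.1))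
      (BlockNorm.ofBlocks (unitTorusGeo L k M) (fun b' : Tor (fine (L ^ r * L ^ k) M) × Fin (d + 1) => blockOf (L ^ r * L ^ k) M b'.1))
      (idef (pull (kingPrV L k r M)) (pull (kingPrV L k r M))
        (symbOp M (L ^ r * L ^ k) (sD M (L ^ r * L ^ k) ν ((L ^ r * L ^ k : ℕ) : ℝ)) ∘ₗ gOp M (L ^ r * L ^ k) a)
        (symbOp M (L ^ k) (sD M (L ^ k) ν ((L ^ k : ℕ) : ℝ)) ∘ₗ gOp M (L ^ k) a))
      (fun y y' => C₀ * Real.exp (-(δ * tdistT M y y'))))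
    (h0b : HasMaj (BlockNorm.ofBlocks (unitTorusGeo L k M) (fun b : Tor (fine (L ^ k) M) × Fin (d + 1) => blockOf (L ^ k) M b.1))
      (BlockNorm.ofBlocks (unitTorusGeo L k M) (fun b' : Tor (fine (L ^ r * L ^ k) M) × Fin (d + 1) => blockOf (L ^ r * L ^ k) M b'.1))
      (idef (pull (kingPrV L k r M)) (pull (kingPrV L k r M))
        (bshiftV M (L ^ r * L ^ k) ν ∘ₗ (symbOp M (L ^ r * L ^ k) (sD M (L ^ r * L ^ k) ν ((L ^ r * L ^ k : ℕ) : ℝ)) ∘ₗ gOp M (L ^ r * L ^ k) a))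
        (bshiftV M (L ^ k) ν ∘ₗ (symbOp M (L ^ k) (sD M (L ^ k) ν ((L ^ k : ℕ) : ℝ)) ∘ₗ gOp M (L ^ k) a)))
      (fun y y' => C₀' * Real.exp (-(δ * tdistT M y y'))))
    (h3a : ∀ μ : Fin (d + 1), HasMaj (BlockNorm.ofBlocks (unitTorusGeo L k M) (fun b : Tor (fine (L ^ k) M) × Fin (d + 1) => blockOf (L ^ k) M b.1))
      (BlockNorm.ofBlocks (unitTorusGeo L k M) (fun b : Tor (fine (L ^ k) M) × Fin (d + 1) => blockOf (L ^ k) M b.1))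
      (symbOp M (L ^ k) (sD M (L ^ k) μ ((L ^ k : ℕ) : ℝ)) ∘ₗ symbOp M (L ^ k) (sD M (L ^ k) ν ((L ^ k : ℕ) : ℝ)) ∘ₗ gOp M (L ^ k) a)
      (fun y y' => C₃ * Real.exp (-(δ * tdistT M y y'))))
    (h3b : ∀ μ : Fin (d + 1), HasMaj (BlockNorm.ofBlocks (unitTorusGeo L k M) (fun b : Tor (fine (L ^ k) M) × Fin (d + 1) => blockOf (L ^ k) M b.1))
      (BlockNorm.ofBlocks (unitTorusGeo L k M) (fun b : Tor (fine (L ^ k) M) × Fin (d + 1) => blockOf (L ^ k) M b.1))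
      (bshiftV M (L ^ k) ν ∘ₗ (symbOp M (L ^ k) (sD M (L ^ k) μ ((L ^ k : ℕ) : ℝ)) ∘ₗ symbOp M (L ^ k) (sD M (L ^ k) ν ((L ^ k : ℕ) : ℝ)) ∘ₗ gOp M (L ^ k) a))
      (fun y y' => C₃' * Real.exp (-(δ * tdistT M y y')))) :
    HasMaj (BlockNorm.ofBlocks (unitTorusGeo L k M) (fun b : Tor (fine (L ^ k) M) × Fin (d + 1) => blockOf (L ^ k) M b.1))
      (BlockNorm.ofBlocks (unitTorusGeo L k M) (fun b' : Tor (fine (L ^ r * L ^ k) M) × Fin (d + 1) => blockOf (L ^ r * L ^ k) M b'.1))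
      (idef (pull (kingPrV L k r M)) (pull (kingPrV L k r M))
        (mulOp (chiCube M (L ^ r * L ^ k) c S) ∘ₗ symbOp M (L ^ r * L ^ k) (sD M (L ^ r * L ^ k) ν ((L ^ r * L ^ k : ℕ) : ℝ)) ∘ₗ neumannCubeG M (L ^ r * L ^ k) c S a)
        (mulOp (chiCube M (L ^ k) c S) ∘ₗ symbOp M (L ^ k) (sD M (L ^ k) ν ((L ^ k : ℕ) : ℝ)) ∘ₗ neumannCubeG M (L ^ k) c S a))
      (fun y y' => ind (cubeBlocks M c S : Set (Tor M)) y * ind (cubeBlocks M c S : Set (Tor M)) y' *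
        (2 ^ d * Real.exp δ * ((C₀ + C₀') + (d + 1) * ((C₃ + C₃') / (L ^ k : ℕ))) * Real.exp (-(δ * tdistT M y y')))) := by
  rw [idef_chiCube_grad_neumannCubeG_split L k r c S a hM ha ν]
  have hK0 : ∀ y y' : Tor M, 0 ≤ C₀ * Real.exp (-(δ * tdistT M y y')) := fun _ _ => mul_nonneg hC₀ (Real.exp_nonneg _)
  have hK0' : ∀ y y' : Tor M, 0 ≤ C₀' * Real.exp (-(δ * tdistT M y y')) := fun _ _ => mul_nonneg hC₀' (Real.exp_nonneg _)
  have hC3 : (0 : ℝ) ≤ (d + 1) * (C₃ / (L ^ k : ℕ)) := by positivity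
  have hC3' : (0 : ℝ) ≤ (d + 1) * (C₃' / (L ^ k : ℕ)) := by positivity
  have hK3 : ∀ y y' : Tor M, 0 ≤ (d + 1) * (C₃ / (L ^ k : ℕ)) * Real.exp (-(δ * tdistT M y y')) := fun _ _ => mul_nonneg hC3 (Real.exp_nonneg _)
  have hK3' : ∀ y y' : Tor M, 0 ≤ (d + 1) * (C₃' / (L ^ k : ℕ)) * Real.exp (-(δ * tdistT M y y')) := fun _ _ => mul_nonneg hC3' (Real.exp_nonneg _)
  -- the images-dressed torus defects
  have hA := fun T : Finset (Fin (d + 1)) => hasMaj_chiCube_reflSet_comp hC₀ hδ hM T (hasMaj_comp_mulOp_chiCube (c := c) (S := S) hK0 h0a)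
  have hA' := fun T : Finset (Fin (d + 1)) => hasMaj_chiCube_reflSet_comp hC₀' hδ hM T (hasMaj_comp_mulOp_chiCube (c := c) (S := S) hK0' h0b)
  -- the face terms: second differences, source-localized, reflected, paired, masked
  have hDa := hasMaj_ownDiff_comp (T := symbOp M (L ^ k) (sD M (L ^ k) ν ((L ^ k : ℕ) : ℝ)) ∘ₗ gOp M (L ^ k) a) hC₃ h3a
  have hXa : HasMaj (BlockNorm.ofBlocks (unitTorusGeo L k M) (fun b : Tor (fine (L ^ k) M) × Fin (d + 1) => blockOf (L ^ k) M b.1))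
      (BlockNorm.ofBlocks (unitTorusGeo L k M) (fun b : Tor (fine (L ^ k) M) × Fin (d + 1) => blockOf (L ^ k) M b.1))
      ((ownDiff M (L ^ k) ∘ₗ symbOp M (L ^ k) (sD M (L ^ k) ν ((L ^ k : ℕ) : ℝ))) ∘ₗ gOp M (L ^ k) a ∘ₗ mulOp (chiCube M (L ^ k) c S))
      (fun y y' => ind (cubeBlocks M c S : Set (Tor M)) y' * ((d + 1) * (C₃ / (L ^ k : ℕ)) * Real.exp (-(δ * tdistT M y y')))) :=
    (hasMaj_comp_mulOp_chiCube (c := c) (S := S) hK3 hDa).congr fun μ => rfl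
  have hB := fun T : Finset (Fin (d + 1)) => hasMaj_faceTerm (r := r) (c := c) hM hC3 hδ T hXa
  have h3b' : ∀ μ : Fin (d + 1), HasMaj (BlockNorm.ofBlocks (unitTorusGeo L k M) (fun b : Tor (fine (L ^ k) M) × Fin (d + 1) => blockOf (L ^ k) M b.1))
      (BlockNorm.ofBlocks (unitTorusGeo L k M) (fun b : Tor (fine (L ^ k) M) × Fin (d + 1) => blockOf (L ^ k) M b.1))
      (symbOp M (L ^ k) (sD M (L ^ k) μ ((L ^ k : ℕ) : ℝ)) ∘ₗ
        (bshiftV M (L ^ k) ν ∘ₗ (symbOp M (L ^ k) (sD M (L ^ k) ν ((L ^ k : ℕ) : ℝ)) ∘ₗ gOp M (L ^ k) a)))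
      (fun y y' => C₃' * Real.exp (-(δ * tdistT M y y'))) := fun μ =>
    (h3b μ).congr fun f => LinearMap.congr_fun
      (symbOp_sD_comp_bshiftV_comp μ ν ((L ^ k : ℕ) : ℝ) (symbOp M (L ^ k) (sD M (L ^ k) ν ((L ^ k : ℕ) : ℝ)) ∘ₗ gOp M (L ^ k) a)).symm f
  have hDb := hasMaj_ownDiff_comp (T := bshiftV M (L ^ k) ν ∘ₗ (symbOp M (L ^ k) (sD M (L ^ k) ν ((L ^ k : ℕ) : ℝ)) ∘ₗ gOp M (L ^ k) a)) hC₃' h3b'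
  have hXb : HasMaj (BlockNorm.ofBlocks (unitTorusGeo L k M) (fun b : Tor (fine (L ^ k) M) × Fin (d + 1) => blockOf (L ^ k) M b.1))
      (BlockNorm.ofBlocks (unitTorusGeo L k M) (fun b : Tor (fine (L ^ k) M) × Fin (d + 1) => blockOf (L ^ k) M b.1))
      ((ownDiff M (L ^ k) ∘ₗ bshiftV M (L ^ k) ν ∘ₗ symbOp M (L ^ k) (sD M (L ^ k) ν ((L ^ k : ℕ) : ℝ))) ∘ₗ gOp M (L ^ k) a ∘ₗ mulOp (chiCube M (L ^ k) c S))
      (fun y y' => ind (cubeBlocks M c S : Set (Tor M)) y' * ((d + 1) * (C₃' / (L ^ k : ℕ)) * Real.exp (-(δ * tdistT M y y')))) :=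
    (hasMaj_comp_mulOp_chiCube (c := c) (S := S) hK3' hDb).congr fun μ => rfl
  have hB' := fun T : Finset (Fin (d + 1)) => hasMaj_faceTerm (r := r) (c := c) hM hC3' hδ T hXb
  refine (hasMaj_finsum ((Finset.univ : Finset (Fin (d + 1))).erase ν).powerset _ _ fun T _ =>
    ((hA T).add (hB T)).sub ((hA' (insert ν T)).add (hB' (insert ν T)))).mono fun y y' => le_of_eq ?_
  rw [Finset.sum_const, Finset.card_powerset, Finset.card_erase_of_mem (Finset.mem_univ ν), Finset.card_univ, Fintype.card_fin, Nat.add_sub_cancel,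
    nsmul_eq_mul]
  push_cast
  ring

/-- ★★★ **THE η-DEFECT LETTER OF ENTRY 1 OF THE NEUMANN CUBE PROPAGATORS AT `U ≡ 1`, HYPOTHESIS-FREE** on the torus family (coarse scales with `L^k ≥ 4`): there are `δ, m > 0` with
`𝔇(χ′_□∇′_νG′(□), χ_□∇_νG(□)) ≤ 1_□(y)1_□(y′)·m·(L^k)^{−1∕16}·e^{−δ|y−y′|_T}` for every torus exponent, refinement, cube position and direction — per image the torus defects of `∇_νG`
(part 53 `hasMaj_twoGridDefect_grad`) and of `S_{−ν}∇_νG` (dag-n15-c W1 `hasMaj_twoGridDefect_grad_backward`), rate `(L^k)^{−1∕16}`; the faces cost `(L^k)^{−1∕2} ≤ (L^k)^{−1∕16}` by the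
Hölder second-difference letter `hasMaj_gradStep_of_ineq` (`α = ½`).  The cube input of dag-n15-c's `hDK` rows (FILES 46∕52∕56 Leibniz).
[cite: Balaban1985BackgroundPropagators, Thm 3.14 pp.426–427, (3.42) p.397 (shape); King1986, Prop. 3.9 (3.73) p.665 (A = 0 model); Balaban1984PropagatorsII, (2.134) p.247, (2.37) p.229] -/
theorem hasMaj_idef_chiCube_grad_neumannCubeG (hLodd : Odd L) (hL2 : 2 ≤ L) {a : ℝ} (ha : 0 < a) :
    ∃ δ m : ℝ, 0 < δ ∧ 0 < m ∧ ∀ (mT k r : ℕ) (hk : 1 ≤ k) (hn4 : 4 ≤ L ^ k) (hL : Odd L ∧ 1 < L) (c : Tor (MP (paramsOf d L mT k hL))) (ν : Fin (d + 1)),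
      HasMaj (BlockNorm.ofBlocks (unitTorusGeo L k (MP (paramsOf d L mT k hL))) (blkFine L k (MP (paramsOf d L mT k hL))))
        (BlockNorm.ofBlocks (unitTorusGeo L k (MP (paramsOf d L mT k hL)))
          (fun i : Tor (fine (L ^ r * L ^ k) (MP (paramsOf d L mT k hL))) × Fin (d + 1) => blockOf (L ^ r * L ^ k) (MP (paramsOf d L mT k hL)) i.1))
        (idef (pull (kingPrV L k r (MP (paramsOf d L mT k hL)))) (pull (kingPrV L k r (MP (paramsOf d L mT k hL))))
          (mulOp (chiCube (MP (paramsOf d L mT k hL)) (L ^ r * L ^ k) c (L ^ mT)) ∘ₗ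
            symbOp (MP (paramsOf d L mT k hL)) (L ^ r * L ^ k) (sD (MP (paramsOf d L mT k hL)) (L ^ r * L ^ k) ν ((L ^ r * L ^ k : ℕ) : ℝ)) ∘ₗ
              neumannCubeG (MP (paramsOf d L mT k hL)) (L ^ r * L ^ k) c (L ^ mT) a)
          (mulOp (chiCube (MP (paramsOf d L mT k hL)) (L ^ k) c (L ^ mT)) ∘ₗ
            symbOp (MP (paramsOf d L mT k hL)) (L ^ k) (sD (MP (paramsOf d L mT k hL)) (L ^ k) ν ((L ^ k : ℕ) : ℝ)) ∘ₗ
              neumannCubeG (MP (paramsOf d L mT k hL)) (L ^ k) c (L ^ mT) a))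
        (fun y y' => ind ((cubeBlocks (MP (paramsOf d L mT k hL)) c (L ^ mT) : Finset _) : Set _) y *
          ind ((cubeBlocks (MP (paramsOf d L mT k hL)) c (L ^ mT) : Finset _) : Set _) y' *
          (m * ((L ^ k : ℕ) : ℝ) ^ (-(1 / 16 : ℝ)) * Real.exp (-(δ * tdistT (MP (paramsOf d L mT k hL)) y y')))) := by
  have hL : Odd L ∧ 1 < L := ⟨hLodd, by omega⟩
  obtain ⟨δ₁, C₁, hδ₁, hC₁, H1⟩ := hasMaj_twoGridDefect_grad (d := d) hLodd hL2 ha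
  obtain ⟨δ₂, C₂, hδ₂, hC₂, H2⟩ := GenuineSite.hasMaj_twoGridDefect_grad_backward (d := d) hLodd hL2 ha
  obtain ⟨δ₀, C, Cα, Cε, Cαε, hδ₀, hC, H3⟩ := ineq110_114_pair (d := d) hL ha
  have hLθ0 : 0 ≤ Lθ (d + 1) := Lθ_nonneg _
  obtain ⟨δ, hδdef⟩ : ∃ δ : ℝ, δ = min (min δ₁ δ₂) δ₀ := ⟨_, rfl⟩
  have hδpos : 0 < δ := hδdef ▸ lt_min (lt_min hδ₁ hδ₂) hδ₀
  have hδ₁le : δ ≤ δ₁ := hδdef ▸ (min_le_left _ _).trans (min_le_left _ _)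
  have hδ₂le : δ ≤ δ₂ := hδdef ▸ (min_le_left _ _).trans (min_le_right _ _)
  have hδ₀le : δ ≤ δ₀ := hδdef ▸ min_le_right _ _
  obtain ⟨CH, hCH⟩ : ∃ CH : ℝ, CH = |Cα (1 / 2)| * (Lθ (d + 1) + 1) * Real.exp δ₀ * Real.exp δ₀ * 2 := ⟨_, rfl⟩
  have hCH0 : 0 ≤ CH := by rw [hCH]; positivity
  have he1 : 1 ≤ Real.exp δ₀ := Real.one_le_exp hδ₀.le
  refine ⟨δ, 2 ^ (d + 1) * Real.exp δ * ((C₁ + C₂) + (d + 1) * CH), hδpos, by positivity, fun mT k r hk hn4 hL' c ν => ?_⟩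
  have hM : ∀ μ, MP (paramsOf d L mT k hL') μ = 2 * L ^ mT := fun μ => rfl
  have hM2 : ∀ μ, 2 ≤ MP (paramsOf d L mT k hL') μ := fun μ => by
    rw [hM μ]; exact Nat.le_mul_of_pos_right 2 (pow_pos (by omega) _)
  have hn1 : 1 ≤ L ^ k := Nat.one_le_pow _ _ (by omega)
  have hnr1 : (1 : ℝ) ≤ ((L ^ k : ℕ) : ℝ) := by exact_mod_cast hn1
  have hnr0 : (0 : ℝ) < ((L ^ k : ℕ) : ℝ) := by linarith
  have hρ0 : 0 ≤ ((L ^ k : ℕ) : ℝ) ^ (-(1 / 16 : ℝ)) := Real.rpow_nonneg hnr0.le _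
  -- the two torus defects at this index, decay weakened to `δ`
  have h0a := hasMaj_rate_mono (A := C₁ * ((L ^ k : ℕ) : ℝ) ^ (-(1 / 16 : ℝ))) (mul_nonneg hC₁.le hρ0) hδ₁le (H1 mT k r hk hL' ν)
  have h0b := hasMaj_rate_mono (A := C₂ * ((L ^ k : ℕ) : ℝ) ^ (-(1 / 16 : ℝ))) (mul_nonneg hC₂.le hρ0) hδ₂le (H2 mT k r hk hL' ν)
  -- the second differences: Hölder letter at `α = ½`, plain and shifted back
  have hS := fun μ => hasMaj_gradStep_of_ineq (L := L) (k := k) (MP (paramsOf d L mT k hL')) (L ^ k) a hn4 hM2 (H3 mT k r hk).1 hδ₀.le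
    (α := 1 / 2) (by norm_num) (by norm_num) μ ν
  have hB0 : 0 ≤ |Cα (1 / 2)| * (Lθ (d + 1) + 1) * Real.exp δ₀ * ((L ^ k : ℕ) : ℝ) ^ (1 - 1 / 2 : ℝ) :=
    mul_nonneg (by positivity) (Real.rpow_nonneg hnr0.le _)
  have h3a := fun μ => hasMaj_rate_mono hB0 hδ₀le (hS μ)
  have h3b := fun μ => hasMaj_rate_mono (mul_nonneg hB0 (Real.exp_nonneg δ₀)) hδ₀le (hasMaj_bshiftV_comp (MP (paramsOf d L mT k hL')) k (L ^ k) hB0 hδ₀.le ν (hS μ))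
  have hmain := hasMaj_idef_chiCube_grad_neumannCubeG_of (r := r) (c := c) hM ha ν (mul_nonneg hC₁.le hρ0) (mul_nonneg hC₂.le hρ0) hB0
    (mul_nonneg hB0 (Real.exp_nonneg δ₀)) hδpos.le h0a h0b h3a h3b
  refine hmain.mono fun y y' => ?_
  -- `(L^k)^{1−½}∕L^k = (L^k)^{−½} ≤ (L^k)^{−1∕16}`
  have hpow : ((L ^ k : ℕ) : ℝ) ^ (1 - 1 / 2 : ℝ) / ((L ^ k : ℕ) : ℝ) ≤ ((L ^ k : ℕ) : ℝ) ^ (-(1 / 16 : ℝ)) := by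
    rw [div_eq_mul_inv, ← Real.rpow_neg_one, ← Real.rpow_add hnr0]
    exact Real.rpow_le_rpow_of_exponent_le hnr1 (by norm_num)
  have hB1 : 0 ≤ |Cα (1 / 2)| * (Lθ (d + 1) + 1) * Real.exp δ₀ := by positivity
  have h2d : (0 : ℝ) ≤ 2 ^ d * Real.exp δ := by positivity
  have hd1 : (0 : ℝ) ≤ (d : ℝ) + 1 := by positivity
  have hsum : (|Cα (1 / 2)| * (Lθ (d + 1) + 1) * Real.exp δ₀ * ((L ^ k : ℕ) : ℝ) ^ (1 - 1 / 2 : ℝ) +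
      |Cα (1 / 2)| * (Lθ (d + 1) + 1) * Real.exp δ₀ * ((L ^ k : ℕ) : ℝ) ^ (1 - 1 / 2 : ℝ) * Real.exp δ₀) / ((L ^ k : ℕ) : ℝ) ≤ CH * ((L ^ k : ℕ) : ℝ) ^ (-(1 / 16 : ℝ)) := by
    rw [hCH, show (|Cα (1 / 2)| * (Lθ (d + 1) + 1) * Real.exp δ₀ * ((L ^ k : ℕ) : ℝ) ^ (1 - 1 / 2 : ℝ) +
      |Cα (1 / 2)| * (Lθ (d + 1) + 1) * Real.exp δ₀ * ((L ^ k : ℕ) : ℝ) ^ (1 - 1 / 2 : ℝ) * Real.exp δ₀) / ((L ^ k : ℕ) : ℝ) =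
      |Cα (1 / 2)| * (Lθ (d + 1) + 1) * Real.exp δ₀ * (1 + Real.exp δ₀) * (((L ^ k : ℕ) : ℝ) ^ (1 - 1 / 2 : ℝ) / ((L ^ k : ℕ) : ℝ)) by ring]
    have h1e : |Cα (1 / 2)| * (Lθ (d + 1) + 1) * Real.exp δ₀ * (1 + Real.exp δ₀) ≤ |Cα (1 / 2)| * (Lθ (d + 1) + 1) * Real.exp δ₀ * (Real.exp δ₀ + Real.exp δ₀) :=
      mul_le_mul_of_nonneg_left (add_le_add_left he1 _) hB1
    calc |Cα (1 / 2)| * (Lθ (d + 1) + 1) * Real.exp δ₀ * (1 + Real.exp δ₀) * (((L ^ k : ℕ) : ℝ) ^ (1 - 1 / 2 : ℝ) / ((L ^ k : ℕ) : ℝ))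
        ≤ |Cα (1 / 2)| * (Lθ (d + 1) + 1) * Real.exp δ₀ * (Real.exp δ₀ + Real.exp δ₀) * ((L ^ k : ℕ) : ℝ) ^ (-(1 / 16 : ℝ)) :=
          mul_le_mul h1e hpow (div_nonneg (Real.rpow_nonneg hnr0.le _) hnr0.le) (mul_nonneg hB1 (by positivity))
      _ = |Cα (1 / 2)| * (Lθ (d + 1) + 1) * Real.exp δ₀ * Real.exp δ₀ * 2 * ((L ^ k : ℕ) : ℝ) ^ (-(1 / 16 : ℝ)) := by ring
  have hcoef : 2 ^ d * Real.exp δ * ((C₁ * ((L ^ k : ℕ) : ℝ) ^ (-(1 / 16 : ℝ)) + C₂ * ((L ^ k : ℕ) : ℝ) ^ (-(1 / 16 : ℝ))) + (d + 1) *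
        ((|Cα (1 / 2)| * (Lθ (d + 1) + 1) * Real.exp δ₀ * ((L ^ k : ℕ) : ℝ) ^ (1 - 1 / 2 : ℝ) +
          |Cα (1 / 2)| * (Lθ (d + 1) + 1) * Real.exp δ₀ * ((L ^ k : ℕ) : ℝ) ^ (1 - 1 / 2 : ℝ) * Real.exp δ₀) / ((L ^ k : ℕ) : ℝ))) ≤
      2 ^ (d + 1) * Real.exp δ * ((C₁ + C₂) + (d + 1) * CH) * ((L ^ k : ℕ) : ℝ) ^ (-(1 / 16 : ℝ)) :=
    calc 2 ^ d * Real.exp δ * ((C₁ * ((L ^ k : ℕ) : ℝ) ^ (-(1 / 16 : ℝ)) + C₂ * ((L ^ k : ℕ) : ℝ) ^ (-(1 / 16 : ℝ))) + (d + 1) *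
          ((|Cα (1 / 2)| * (Lθ (d + 1) + 1) * Real.exp δ₀ * ((L ^ k : ℕ) : ℝ) ^ (1 - 1 / 2 : ℝ) +
            |Cα (1 / 2)| * (Lθ (d + 1) + 1) * Real.exp δ₀ * ((L ^ k : ℕ) : ℝ) ^ (1 - 1 / 2 : ℝ) * Real.exp δ₀) / ((L ^ k : ℕ) : ℝ)))
        ≤ 2 ^ d * Real.exp δ * ((C₁ * ((L ^ k : ℕ) : ℝ) ^ (-(1 / 16 : ℝ)) + C₂ * ((L ^ k : ℕ) : ℝ) ^ (-(1 / 16 : ℝ))) + (d + 1) * (CH * ((L ^ k : ℕ) : ℝ) ^ (-(1 / 16 : ℝ)))) :=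
          mul_le_mul_of_nonneg_left (add_le_add_right (mul_le_mul_of_nonneg_left hsum hd1) _) h2d
      _ = 2 ^ d * Real.exp δ * ((C₁ + C₂) + (d + 1) * CH) * ((L ^ k : ℕ) : ℝ) ^ (-(1 / 16 : ℝ)) := by ring
      _ ≤ 2 ^ (d + 1) * Real.exp δ * ((C₁ + C₂) + (d + 1) * CH) * ((L ^ k : ℕ) : ℝ) ^ (-(1 / 16 : ℝ)) := by
          have : (2 : ℝ) ^ d ≤ 2 ^ (d + 1) := by rw [pow_succ]; linarith [pow_pos (by norm_num : (0 : ℝ) < 2) d]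
          have hin : 0 ≤ Real.exp δ * ((C₁ + C₂) + (d + 1) * CH) * ((L ^ k : ℕ) : ℝ) ^ (-(1 / 16 : ℝ)) := by positivity
          nlinarith [this, hin]
  exact mul_le_mul_of_nonneg_left (mul_le_mul_of_nonneg_right hcoef (Real.exp_nonneg _)) (mul_nonneg (ind_nonneg _ _) (ind_nonneg _ _))

end GradientLetter

end Summit.QuantumFields.YangMills.BalabanUVNodes.N15.TwoGrid
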